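import Summits.CriticalPhenomena.Ising3DConformalLimit.Theorems.StrandShadow.Negative.ClusterDecomposition
import Summits.CriticalPhenomena.Ising3DConformalLimit.Theorems.FKParityRobustnessStrandShadowComposition
import Summits.CriticalPhenomena.Ising3DConformalLimit.Theorems.FKParityRobustnessStrandShadowAizenmanPairings
import Summits.CriticalPhenomena.Ising3DConformalLimit.Theorems.FKParityRobustnessParityBoundCurrents
import Literature.Probability.LatticeModels.WeightedCurrentsIdentities
import Literature.Probability.LatticeModels.LoopO1
import Literature.Probability.LatticeModels.ModifiedSimonInequality
import Literature.Probability.LatticeModels.ThermodynamicLimit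
import Literature.Probability.LatticeModels.BoxTwoPointTransfer
import Literature.Probability.LatticeModels.CriticalTwoPointBounds
import Literature.Probability.LatticeModels.SharpnessProofs
import Literature.Probability.LatticeModels.CriticalCorrWellDefined
import Literature.Probability.LatticeModels.CorrelationInequalitiesProofs
import Literature.Probability.LatticeModels.IsingTransport
import Literature.Probability.LatticeModels.GKSInequalities
import HarnessLib

/-!
# The junk term of the formal crux is `O(1/l)` on `Λ_N ⊂ ℤ³` at `β_c` (crux `StrandShadow`, stmt-CriticalPhenomena-14626)

Support file for the stub `junkRatio_lattice_le` of the line `odd-cluster-cut-exact-helper`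
(route `FKParityRobustness`).  `G_N` is the box graph on `Λ_N = {−N..N}³`, `t = tanh β_c(3)`,
`a = l·tetra`, `Z_S = Σ_{F ∈ 𝒯_S} t^{|F|}`, `G_{ij} = ⟨σ_{a_i}σ_{a_j}⟩^free_{Λ_N}`, and
`J = Σ_{F ∈ 𝒯_{a₀a₁} : a₀ ↔ a₂, a₀ ↔ a₃ in F} t^{|F|}` is the junk mass; then `J ≤ (C/l)·Z₀₁·G₂₃`.
Chain: (1) `J·Z∅ ≤ Z_A·Z₂₃` on every finite graph (`junkL_junkBound`: odd-part pushforward,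
`odd(n₁) ⊆ trace(n₁+n₂)`, switching lemma with the pair `{a₂,a₃}`); (2) HT dictionary
`Z_S = ⟨σ_S⟩·Z∅`; (3) Lebowitz `⟨σ_A⟩ ≤ ΣGG` and the tetrahedral symmetry `ΣGG = 3G₀₁G₂₃`;
(4) `G₂₃ ≤ S_{β_c}(a₃ − a₂) = ⟨σ₀σ_{(−2l,2l,0)}⟩⁺_{β_c} ≤ C_IR/(2l)` (volume monotonicity,
`μ^f_{β_c} = μ⁺_{β_c}`, infrared bound on `ℤ³`).

References: M. Aizenman, Comm. Math. Phys. 86 (1982), Prop. 5.1 [AizenmanCMP1982]; J. L. Lebowitz,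
Comm. Math. Phys. 35 (1974) 87 [Lebowitz1974]; Aizenman–Duminil-Copin–Sidoravicius, CMP 334 (2015). -/

noncomputable section

open Finset SimpleGraph
open Literature.Probability.LatticeModels
open Literature.Probability.Percolation (zdSignedPermIso signedPerm_mem_box_iff)

namespace Summit.CriticalPhenomena.Ising3DConformalLimit.Theorems.StrandShadowOddCut

open scoped Classical

section CurrentSide

variable {V : Type*} [Fintype V] [DecidableEq V] (G : SimpleGraph V) [DecidableRel G.Adj]

open scoped ENNReal symmDiff

/-- **The junk bound on a finite graph** (`β ≥ 0`, `a` injective, `t = tanh β`):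
`J·Z^∅_t ≤ Z^A_t·Z^{a₂a₃}_t`.  Current side (`ℝ≥0∞`): `cosh(β)^{|E|}·J·Z_β[∅] ≤ Z_β[A]·Z_β[{a₂,a₃}]`
by the odd-part pushforward, `odd(n₁) ⊆ trace(n₁+n₂)` (so `a₂ ↔ a₀ ↔ a₃` in `odd(n₁)` puts
`a₃ ∈ C_{n₁+n₂}(a₂)`) and the switching lemma with the pair `{a₂,a₃}`
(`Current.tsum_epairWeight_switch_pair`) read backwards; then divide by `cosh(β)^{2|E|}`.
(This is the neighbouring stub `junkMass_mul_loopZero_le` of the line, landed in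
`Theorems/FKParityRobustnessStrandShadowJunkBound.lean`; re-proved privately while that module's
olean is unavailable to importers.) -/
theorem junkL_junkBound {β : ℝ} (hβ : 0 ≤ β) (a : Fin 4 → V) (ha : Function.Injective a) :
    (∑ F ∈ (tJoins G Set.univ {a 0, a 1}).filter (fun F : Finset (Sym2 V) =>
            (SimpleGraph.fromEdgeSet (↑F : Set (Sym2 V))).Reachable (a 0) (a 2) ∧
            (SimpleGraph.fromEdgeSet (↑F : Set (Sym2 V))).Reachable (a 0) (a 3)),
          Real.tanh β ^ F.card) * loopO1PartitionFunction G (Real.tanh β) ∅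
        ≤ loopO1PartitionFunction G (Real.tanh β) (Finset.univ.image a) *
            loopO1PartitionFunction G (Real.tanh β) {a 2, a 3} := by
  have ht : 0 ≤ Real.tanh β := by
    rw [Real.tanh_eq_sinh_div_cosh]
    exact div_nonneg (Real.sinh_nonneg_iff.2 hβ) (Real.cosh_pos β).le
  have hc : 0 < Real.cosh β ^ #G.edgeFinset := pow_pos (Real.cosh_pos β) _
  have hZ := fun S => mul_nonneg hc.le (loopO1PartitionFunction_nonneg G ht S)
  -- one-copy odd-part pushforward with an event `P` on edge sets:
  -- `Σ_{∂n = S} w_β(n)·1[odd(n) ∈ P] = cosh(β)^{|E|} · Σ_{F ∈ 𝒯_S, P F} tanh(β)^{|F|}`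
  have hpush : ∀ (S : Finset V) (P : Finset (Sym2 V) → Prop) [DecidablePred P],
      ∑' n : Current G, (if n.sources = S then n.eweight (fun _ : G.edgeFinset => β) else 0) *
          (if P ((univ.filter fun e : G.edgeFinset => Odd (n e)).map (Function.Embedding.subtype _))
            then 1 else 0) =
        ENNReal.ofReal (Real.cosh β ^ #G.edgeFinset *
          ∑ F ∈ (tJoins G Set.univ S).filter (fun F => P F), Real.tanh β ^ #F) := by
    intro S P _
    -- pattern: `tsum_sources_eweight_joinsAll_eq` (Theorems/FKParityRobustnessParityBoundCurrents.lean)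
    rw [tsum_sources_eweight_mul_apply_oddPart hβ S (fun F => if P F then 1 else 0), Finset.mul_sum,
      ENNReal.ofReal_sum_of_nonneg (fun F _ => by positivity), tJoins, Finset.sum_filter,
      Finset.sum_filter]
    refine Finset.sum_congr rfl fun F hF => ?_
    have hle : #F ≤ #G.edgeFinset := Finset.card_le_card (Finset.mem_powerset.1 hF)
    by_cases hc : (∀ v, Odd #(F.filter (v ∈ ·)) ↔ v ∈ S)
    · have hc' : (↑F : Set (Sym2 V)) ⊆ Set.univ ∧ (∀ v, Odd #(F.filter (v ∈ ·)) ↔ v ∈ S) :=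
        ⟨Set.subset_univ _, hc⟩
      rw [if_pos hc, if_pos hc']
      by_cases hP : P F
      · rw [if_pos hP, if_pos hP, mul_one, sinh_pow_mul_cosh_pow_sub β hle]
      · rw [if_neg hP, if_neg hP, mul_zero]
    · have hc' : ¬ ((↑F : Set (Sym2 V)) ⊆ Set.univ ∧ (∀ v, Odd #(F.filter (v ∈ ·)) ↔ v ∈ S)) :=
        fun h => hc h.2
      rw [if_neg hc, if_neg hc']
  have key : ENNReal.ofReal (Real.cosh β ^ #G.edgeFinset *
        ∑ F ∈ (tJoins G Set.univ {a 0, a 1}).filter (fun F : Finset (Sym2 V) =>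
            (SimpleGraph.fromEdgeSet (↑F : Set (Sym2 V))).Reachable (a 0) (a 2) ∧
            (SimpleGraph.fromEdgeSet (↑F : Set (Sym2 V))).Reachable (a 0) (a 3)),
          Real.tanh β ^ #F) * ecurrentSum (fun _ : G.edgeFinset => β) ∅ ≤
      ecurrentSum (fun _ : G.edgeFinset => β) (Finset.univ.image a) *
        ecurrentSum (fun _ : G.edgeFinset => β) {a 2, a 3} := by
    -- pattern: `strandsJoinBound_proof` (Theorems/FKParityRobustnessStrandsJoinBound.lean)
    set P : Finset (Sym2 V) → Prop := fun F =>
      (SimpleGraph.fromEdgeSet (↑F : Set (Sym2 V))).Reachable (a 0) (a 2) ∧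
      (SimpleGraph.fromEdgeSet (↑F : Set (Sym2 V))).Reachable (a 0) (a 3) with hP
    set odd : Current G → Finset (Sym2 V) := fun n =>
      (univ.filter fun e : G.edgeFinset => Odd (n e)).map (Function.Embedding.subtype _) with hodd
    have h23 : ({a 2} : Finset V) ∆ {a 3} = {a 2, a 3} :=
      Current.symmDiff_singleton_eq_pair (ha.ne (by decide))
    have hA : ({a 0, a 1} : Finset V) ∆ ({a 2} ∆ {a 3}) = Finset.univ.image a := by
      rw [← Current.symmDiff_singleton_eq_pair (ha.ne (by decide) : a 0 ≠ a 1), symmDiff_assoc]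
      exact aizLoop_symmDiff_eq_image ha
    have hcl : ∀ p : Current G × Current G, P (odd p.1) → a 3 ∈ (p.1 + p.2).cluster (a 2) := by
      intro p h
      have hle : SimpleGraph.fromEdgeSet (↑(odd p.1) : Set (Sym2 V)) ≤
          Literature.Probability.Percolation.openGraph (p.1 + p.2).traced :=
        SimpleGraph.fromEdgeSet_mono (coe_oddPart_subset_traced_add p.1 p.2)
      exact Current.mem_cluster_iff.2 ((h.1.symm.trans h.2).mono hle)
    rw [← hpush {a 0, a 1} P]
    calc (∑' n : Current G, (if n.sources = {a 0, a 1} then n.eweight (fun _ : G.edgeFinset => β)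
            else 0) * (if P (odd n) then 1 else 0)) * ecurrentSum (fun _ : G.edgeFinset => β) ∅
          = ∑' p : Current G × Current G, epairWeight (fun _ : G.edgeFinset => β) {a 0, a 1} ∅ p *
              (if P (odd p.1) then 1 else 0) := by
          unfold ecurrentSum
          rw [tsum_mul_tsum_eq_tsum_prod]
          refine tsum_congr fun p => ?_
          rw [epairWeight_eq_mul]
          ring
      _ ≤ ∑' p : Current G × Current G, epairWeight (fun _ : G.edgeFinset => β) {a 0, a 1} ∅ p *
            ((fun _ : Current G => (1 : ℝ≥0∞)) (p.1 + p.2) *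
              (if a 3 ∈ (p.1 + p.2).cluster (a 2) then 1 else 0)) := by
          refine ENNReal.tsum_le_tsum fun p => mul_le_mul' le_rfl ?_
          rw [one_mul]
          by_cases h : P (odd p.1)
          · rw [if_pos h, if_pos (hcl p h)]
          · rw [if_neg h]
            exact bot_le
      _ = ∑' p : Current G × Current G, epairWeight (fun _ : G.edgeFinset => β)
            ({a 0, a 1} ∆ ({a 2} ∆ {a 3})) ({a 2} ∆ {a 3}) p *
              (fun _ : Current G => (1 : ℝ≥0∞)) (p.1 + p.2) :=
          (Current.tsum_epairWeight_switch_pair (fun _ => hβ) {a 0, a 1} (a 2) (a 3) (fun _ => 1)).symm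
      _ = ecurrentSum (fun _ : G.edgeFinset => β) (Finset.univ.image a) *
            ecurrentSum (fun _ : G.edgeFinset => β) {a 2, a 3} := by
          rw [hA, h23, ← tsum_epairWeight]
          exact tsum_congr fun p => mul_one _
  rw [aizLoop_ecurrentSum_eq G hβ, aizLoop_ecurrentSum_eq G hβ, aizLoop_ecurrentSum_eq G hβ,
    ← ENNReal.ofReal_mul' (hZ _), ← ENNReal.ofReal_mul (hZ _),
    ENNReal.ofReal_le_ofReal_iff (mul_nonneg (hZ _) (hZ _))] at key
  refine le_of_mul_le_mul_left ?_ (mul_pos hc hc)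
  calc _ = _ := by ring
    _ ≤ _ := key
    _ = _ := by ring

end CurrentSide

/-- Tetrahedral symmetry of the free pair correlations of `(Λ_N, l·tetra)`: `G₀₂ = G₀₁ = G₀₃`,
`G₁₃ = G₂₃ = G₁₂` — the coordinate transpositions `y ↔ z`, `x ↔ z` are automorphisms of the box
graph fixing `a₀` and swapping `a₁ ↔ a₂`, resp. `a₁ ↔ a₃` (`isingCorr_map_equiv`). -/
theorem junkL_corr_symmetry (l N : ℕ) (a : Fin 4 → ↥(box 3 N))
    (ha : ∀ i, ((a i : Site 3)) = (l : ℤ) •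
        (![![-1, -1, -1], ![1, 1, -1], ![1, -1, 1], ![-1, 1, 1]] : Fin 4 → Site 3) i) (β : ℝ) :
    (let G := ((zdGraph 3).comap (Subtype.val : ↥(box 3 N) → Site 3))
     let Gc : Fin 4 → Fin 4 → ℝ := fun i j => isingCorr G Finset.univ β 0 .free {a i, a j}
     Gc 0 2 = Gc 0 1 ∧ Gc 0 3 = Gc 0 1 ∧ Gc 1 3 = Gc 2 3 ∧ Gc 1 2 = Gc 2 3) := by
  -- adapted from `StrandShadowSketch.stub_symmetry`
  -- (Theorems/FKParityRobustnessStrandShadowSymmetry.lean)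
  dsimp only
  have hbox : ∀ π : Equiv.Perm (Fin 3), ∃ ψ : ↥(box 3 N) ≃ ↥(box 3 N),
      (∀ x, ((ψ x : ↥(box 3 N)) : Site 3) = Site.signedPerm π 1 (x : Site 3)) ∧
      ∀ x y, ((zdGraph 3).comap (Subtype.val : ↥(box 3 N) → Site 3)).Adj (ψ x) (ψ y) ↔
        ((zdGraph 3).comap (Subtype.val : ↥(box 3 N) → Site 3)).Adj x y := fun π =>
    ⟨(Site.signedPerm π 1).subtypeEquiv fun x => (signedPerm_mem_box_iff π 1).symm, fun x => rfl,
      fun x y => (zdSignedPermIso π 1).map_rel_iff'⟩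
  obtain ⟨ψ₁, hψ₁, hadj₁⟩ := hbox (Equiv.swap (1 : Fin 3) 2)
  obtain ⟨ψ₂, hψ₂, hadj₂⟩ := hbox (Equiv.swap (0 : Fin 3) 2)
  have h₁ : ∀ i, ψ₁ (a i) = a (Equiv.swap (1 : Fin 4) 2 i) := by
    intro i
    apply Subtype.ext
    rw [hψ₁, ha, ha]
    ext k
    fin_cases i <;> fin_cases k <;> simp [Equiv.swap_apply_of_ne_of_ne]
  have h₂ : ∀ i, ψ₂ (a i) = a (Equiv.swap (1 : Fin 4) 3 i) := by
    intro i
    apply Subtype.ext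
    rw [hψ₂, ha, ha]
    ext k
    fin_cases i <;> fin_cases k <;> simp [Equiv.swap_apply_of_ne_of_ne]
  have hc₁ := fun i j => isingCorr_map_equiv ((zdGraph 3).comap (Subtype.val : ↥(box 3 N) → Site 3))
    ψ₁ hadj₁ (Λ := Finset.univ) (fun x => by simp) β 0 .free (fun _ => rfl) {a i, a j}
  have hc₂ := fun i j => isingCorr_map_equiv ((zdGraph 3).comap (Subtype.val : ↥(box 3 N) → Site 3))
    ψ₂ hadj₂ (Λ := Finset.univ) (fun x => by simp) β 0 .free (fun _ => rfl) {a i, a j}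
  simp only [Finset.map_insert, Finset.map_singleton, Equiv.coe_toEmbedding, h₁, h₂] at hc₁ hc₂
  refine ⟨hc₁ 0 1, hc₂ 0 1, hc₁ 2 3, ?_⟩
  rw [← hc₂ 2 3]
  exact congrArg _ (Finset.pair_comm _ _)

/-- Lebowitz' inequality `U₄ ≤ 0` in the set-correlation dress: for four distinct vertices of
`Λ`, `⟨σ_A⟩ ≤ G₀₁G₂₃ + G₀₂G₁₃ + G₀₃G₁₂` (free b.c., zero field, `β ≥ 0`; `lebowitz_holds`). -/
theorem junkL_lebowitz {V : Type*} [DecidableEq V] (G : SimpleGraph V) [G.LocallyFinite]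
    {β : ℝ} (hβ : 0 ≤ β) (Λ : Finset V) (a : Fin 4 → V) (ha : Function.Injective a)
    (haΛ : ∀ i, a i ∈ Λ) :
    isingCorr G Λ β 0 .free (Finset.univ.image a) ≤
      isingCorr G Λ β 0 .free {a 0, a 1} * isingCorr G Λ β 0 .free {a 2, a 3}
      + isingCorr G Λ β 0 .free {a 0, a 2} * isingCorr G Λ β 0 .free {a 1, a 3}
      + isingCorr G Λ β 0 .free {a 0, a 3} * isingCorr G Λ β 0 .free {a 1, a 2} := by
  have hleb := lebowitz_holds G hβ Λ a haΛ
  have hpair : ∀ i j, i ≠ j → twoPoint (isingMeasure G Λ β 0 .free) spinAt (a i) (a j) =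
      isingCorr G Λ β 0 .free {a i, a j} := by
    intro i j hij
    change isingExpect G Λ β 0 .free (spinPair (a i) (a j)) =
      isingExpect G Λ β 0 .free (spinProduct {a i, a j})
    congr 1
    funext s
    simp [spinProduct, spinPair, Finset.prod_pair (ha.ne hij)]
  have h4 : nPoint (isingMeasure G Λ β 0 .free) spinAt a =
      isingCorr G Λ β 0 .free (Finset.univ.image a) := by
    change isingExpect G Λ β 0 .free (spinMonomial a) =
      isingExpect G Λ β 0 .free (spinProduct (Finset.univ.image a))
    congr 1
    funext s
    unfold spinMonomial spinProduct
    rw [Finset.prod_image fun i _ j _ h => ha h]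
  simp only [connectedFour, h4,
    hpair 0 1 (by decide), hpair 2 3 (by decide), hpair 0 2 (by decide), hpair 1 3 (by decide),
    hpair 0 3 (by decide), hpair 1 2 (by decide)] at hleb
  linarith

/-- **Lattice decay of `G₂₃`**: `⟨σ_{a₂}σ_{a₃}⟩^free_{Λ_N;β_c} ≤ C_IR/(2l)` — the free state of the
box graph is the free state of `ℤ³` in the box (`isingTwoPoint_free_map`), volume monotonicity
`⟨σσ⟩^∅_Λ ≤ S_{β_c}` (`isingTwoPoint_box_le_twoPointFree`), `S_{β_c} = ⟨σ₀σ_x⟩⁺_{β_c}`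
(`twoPointFree_criticalBeta_eq_criticalTwoPoint`), the infrared bound `⟨σ₀σ_x⟩⁺_{β_c} ≤ C‖x‖⁻¹`
on `ℤ³` (`criticalTwoPoint_bounds_holds`), and `‖a₃ − a₂‖_∞ = ‖(−2l, 2l, 0)‖_∞ = 2l`. -/
theorem junkL_decay : ∃ C : ℝ, ∀ l : ℕ, 1 ≤ l → ∀ N : ℕ, ∀ a : Fin 4 → ↥(box 3 N),
    (∀ i, ((a i : Site 3)) = (l : ℤ) •
        (![![-1, -1, -1], ![1, 1, -1], ![1, -1, 1], ![-1, 1, 1]] : Fin 4 → Site 3) i) →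
    isingCorr ((zdGraph 3).comap (Subtype.val : ↥(box 3 N) → Site 3)) Finset.univ
        (criticalBeta 3) 0 .free {a 2, a 3} ≤ C / (2 * l) := by
  obtain ⟨c₀, C₀, -, hbd⟩ := criticalTwoPoint_bounds_holds (d := 3) (by norm_num)
  refine ⟨C₀, fun l hl N a ha => ?_⟩
  have hβ : 0 ≤ criticalBeta 3 := criticalBeta_nonneg 3
  have hne : a 2 ≠ a 3 := fun h => by
    simpa using Cruxes.ParityRobustMerging.PlaquetteXorSurgery.tetra_injective hl a ha h
  set G := (zdGraph 3).comap (Subtype.val : ↥(box 3 N) → Site 3) with hG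
  -- the norm of `a₃ − a₂ = (−2l, 2l, 0)`
  have hx : ∀ i, (((a 3 : Site 3) - (a 2 : Site 3)) i).natAbs = if i = 2 then 0 else 2 * l := by
    intro i
    rw [Pi.sub_apply, ha, ha]
    fin_cases i <;> simp <;> omega
  have hx0 : (a 3 : Site 3) - (a 2 : Site 3) ≠ 0 := by
    intro h
    have := hx 1
    rw [h] at this
    simp at this
    omega
  have hnorm : ‖(a 3 : Site 3) - (a 2 : Site 3)‖ = 2 * l := by
    rw [Site.norm_eq_supNorm]
    have h1 : Site.supNorm ((a 3 : Site 3) - (a 2 : Site 3)) = 2 * l := by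
      apply le_antisymm
      · rw [Site.supNorm_le_iff]
        intro i
        rw [hx]
        split_ifs <;> omega
      · have := Site.natAbs_le_supNorm ((a 3 : Site 3) - (a 2 : Site 3)) 0
        rw [hx] at this
        simpa using this
    rw [h1]
    push_cast
    ring
  -- transport to the volume formulation and the infinite-volume bounds
  have h1 : isingCorr G Finset.univ (criticalBeta 3) 0 .free {a 2, a 3} =
      isingTwoPoint G Finset.univ (criticalBeta 3) 0 .free (a 2) (a 3) := by
    simp only [isingCorr, isingTwoPoint]
    congr 1
    funext s
    simp [spinProduct, spinPair, Finset.prod_pair hne]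
  have hmap : (Finset.univ : Finset ↥(box 3 N)).map (Function.Embedding.subtype _) = box 3 N := by
    rw [Finset.univ_eq_attach, Finset.attach_map_val]
  have h2 : isingTwoPoint G Finset.univ (criticalBeta 3) 0 .free (a 2) (a 3) =
      isingTwoPoint (zdGraph 3) (box 3 N) (criticalBeta 3) 0 .free (a 2 : Site 3) (a 3 : Site 3) := by
    -- adapted from `isingTwoPoint_boxGraph` (Theorems/FKFourConnectivity/Negative/LatticeNecessity.lean)
    have h := isingTwoPoint_free_map (G := G) (G' := zdGraph 3)
      (Function.Embedding.subtype (· ∈ box 3 N)) (Λ := Finset.univ) (fun _ _ _ _ => Iff.rfl)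
      (criticalBeta 3) 0 (a 2) (a 3)
    rw [hmap] at h
    exact h.symm
  have h3 : isingTwoPoint (zdGraph 3) (box 3 N) (criticalBeta 3) 0 .free (a 2 : Site 3) (a 3 : Site 3)
      ≤ twoPointFree 3 (criticalBeta 3) ((a 3 : Site 3) - (a 2 : Site 3)) :=
    isingTwoPoint_box_le_twoPointFree hβ (a 2).2 (a 3).2
  rw [twoPointFree_criticalBeta_eq_criticalTwoPoint criticalCorr_wellDefined_holds (by norm_num)] at h3
  have h4 := (hbd _ hx0).2
  have h5 : ∀ r : ℝ, r ^ (-(((3 : ℕ) : ℝ) - 2)) = r⁻¹ := fun r => by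
    rw [show (-(((3 : ℕ) : ℝ) - 2)) = -1 by norm_num, Real.rpow_neg_one]
  rw [hnorm, h5] at h4
  rw [h1, h2, div_eq_mul_inv]
  exact h3.trans h4

/-- The real arithmetic of the junk ratio: `J·Z∅ ≤ Z_A·Z₂₃`, the HT dictionary `Z_S = ⟨σ_S⟩·Z∅`,
Lebowitz, the tetrahedral symmetry and `G₂₃ ≤ C/(2l)` give `J ≤ (3C/2)/l · Z₀₁G₂₃`. -/
theorem junkL_arith {J Z0 Z01 Z23 ZA σA G01 G23 G02 G13 G03 G12 C l : ℝ}
    (hJ : J * Z0 ≤ ZA * Z23) (hdA : σA * Z0 = ZA) (hd23 : G23 * Z0 = Z23) (hd01 : G01 * Z0 = Z01)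
    (hZ0 : 0 < Z0) (hZ01 : 0 ≤ Z01) (hZ23 : 0 ≤ Z23)
    (hleb : σA ≤ G01 * G23 + G02 * G13 + G03 * G12)
    (hs02 : G02 = G01) (hs03 : G03 = G01) (hs13 : G13 = G23) (hs12 : G12 = G23)
    (hG23 : G23 ≤ C / (2 * l)) (hl : 0 < l) :
    J ≤ 3 * C / 2 / l * (Z01 * G23) := by
  have hG23nn : 0 ≤ G23 := by
    have : G23 = Z23 / Z0 := by rw [← hd23, mul_div_cancel_right₀ _ hZ0.ne']
    rw [this]
    exact div_nonneg hZ23 hZ0.le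
  have hσ : σA ≤ 3 * (G01 * G23) := by
    rw [hs02, hs03, hs13, hs12] at hleb
    linarith
  have h1 : J ≤ σA * G23 * Z0 := by
    refine le_of_mul_le_mul_right ?_ hZ0
    calc J * Z0 ≤ ZA * Z23 := hJ
      _ = σA * G23 * Z0 * Z0 := by rw [← hdA, ← hd23]; ring
  calc J ≤ σA * G23 * Z0 := h1
    _ ≤ 3 * (G01 * G23) * G23 * Z0 :=
        mul_le_mul_of_nonneg_right (mul_le_mul_of_nonneg_right hσ hG23nn) hZ0.le
    _ = 3 * G23 * (Z01 * G23) := by rw [← hd01]; ring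
    _ ≤ 3 * (C / (2 * l)) * (Z01 * G23) :=
        mul_le_mul_of_nonneg_right (mul_le_mul_of_nonneg_left hG23 (by norm_num))
          (mul_nonneg hZ01 hG23nn)
    _ = 3 * C / 2 / l * (Z01 * G23) := by
        field_simp

/-- **junkRatio_lattice_le** (ℤ³, `β_c(3)`, `a = l·tetra ⊂ Λ_N`): the junk term of the formal
crux is `O(1/l)` relative to `Z₀₁·G₂₃`: there is `C` such that for every `l ≥ 1` and all large
`N`, `J ≤ (C/l)·Z₀₁·G₂₃`.  Chain: `J·Z∅ ≤ Z_A·Z₂₃` (`junkMass_mul_loopZero_le`) and the HT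
dictionary `Z_S = ⟨σ_S⟩·Z∅` give `J ≤ (⟨σ_A⟩/G₀₁)·Z₀₁·G₂₃`; Lebowitz `⟨σ_A⟩ ≤ ΣGG` and the
tetrahedral symmetry (`ΣGG = 3G₀₁G₂₃`) give `⟨σ_A⟩/G₀₁ ≤ 3G₂₃`; and
`G₂₃ = ⟨σ_{a₂}σ_{a₃}⟩^free_{Λ_N} ≤ S_{β_c}(a₃ − a₂) = ⟨σ₀σ_{(−2l,2l,0)}⟩⁺_{β_c} ≤ C_IR/(2l)` (volume
monotonicity `isingTwoPoint_box_le_twoPointFree`, `μ^f_{β_c} = μ⁺_{β_c}`, infrared bound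
`criticalTwoPoint_bounds_holds` with `d = 3`). -/
theorem junkRatio_lattice_le :
    ∃ C : ℝ, ∀ l : ℕ, 1 ≤ l → ∃ N₀ : ℕ, ∀ N : ℕ, N₀ ≤ N → ∀ a : Fin 4 → ↥(box 3 N),
      (∀ i, ((a i : Site 3)) = (l : ℤ) •
        (![![-1, -1, -1], ![1, 1, -1], ![1, -1, 1], ![-1, 1, 1]] : Fin 4 → Site 3) i) →
      (let G := ((zdGraph 3).comap (Subtype.val : ↥(box 3 N) → Site 3))
       let β : ℝ := criticalBeta 3
       let t : ℝ := Real.tanh β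
       (∑ F ∈ (tJoins G Set.univ {a 0, a 1}).filter (fun F : Finset (Sym2 ↥(box 3 N)) =>
            (SimpleGraph.fromEdgeSet (↑F : Set (Sym2 ↥(box 3 N)))).Reachable (a 0) (a 2) ∧
            (SimpleGraph.fromEdgeSet (↑F : Set (Sym2 ↥(box 3 N)))).Reachable (a 0) (a 3)),
          t ^ F.card)
         ≤ C / l * (loopO1PartitionFunction G t {a 0, a 1} * isingCorr G Finset.univ β 0 .free {a 2, a 3})) := by
  obtain ⟨C₀, hdec⟩ := junkL_decay
  refine ⟨3 * C₀ / 2, fun l hl => ⟨0, fun N _ a ha => ?_⟩⟩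
  dsimp only
  have hβ : 0 ≤ criticalBeta 3 := criticalBeta_nonneg 3
  have ht : 0 ≤ Real.tanh (criticalBeta 3) := by
    rw [Real.tanh_eq_sinh_div_cosh]
    exact div_nonneg (Real.sinh_nonneg_iff.2 hβ) (Real.cosh_pos _).le
  have hinj : Function.Injective a :=
    Cruxes.ParityRobustMerging.PlaquetteXorSurgery.tetra_injective hl a ha
  have hsym := junkL_corr_symmetry l N a ha (criticalBeta 3)
  dsimp only at hsym
  obtain ⟨hs02, hs03, hs13, hs12⟩ := hsym
  -- the finite-graph junk bound at `(G_N, β_c, a)` (the neighbouring stub `junkMass_mul_loopZero_le`)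
  have hJ := junkL_junkBound ((zdGraph 3).comap (Subtype.val : ↥(box 3 N) → Site 3)) hβ a hinj
  have key := junkL_arith hJ
    (StrandShadowSketch.isingCorr_univ_mul_loopO1_empty _ _ (Finset.univ.image a))
    (StrandShadowSketch.isingCorr_univ_mul_loopO1_empty _ _ {a 2, a 3})
    (StrandShadowSketch.isingCorr_univ_mul_loopO1_empty _ _ {a 0, a 1})
    (loopO1PartitionFunction_empty_pos _ ht) (loopO1PartitionFunction_nonneg _ ht _)
    (loopO1PartitionFunction_nonneg _ ht _)
    (junkL_lebowitz _ hβ Finset.univ a hinj (fun _ => Finset.mem_univ _))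
    hs02 hs03 hs13 hs12 (hdec l hl N a ha) (by exact_mod_cast hl)
  convert key

end Summit.CriticalPhenomena.Ising3DConformalLimit.Theorems.StrandShadowOddCut

end
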